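import Literature.Analysis.FunctionSpaces.TorusSobolevSpace
import Literature.Analysis.FunctionSpaces.TorusFourierCalculus
import Literature.Analysis.FunctionSpaces.TorusVectorParseval
import HarnessLib

/-!
# `𝒱 ⊆ V` on the flat torus: discharge of `Torus.smoothSolenoidal_subset_energySpaceV`

`Literature.Analysis.FunctionSpaces.TorusSobolevSpace` defines, for real vector fields on `T^d`,
the set `𝒱 = Torus.smoothSolenoidal d` of `L²` classes of smooth divergence-free mean-zero fields,
the energy space `H = Torus.energySpace d` (the `L²` closure of `span 𝒱`) and
`V = Torus.energySpaceV d = {v ∈ H | complexify ∘ v ∈ H¹(T^d)}`, and vendors as the named fact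
`Torus.smoothSolenoidal_subset_energySpaceV` the inclusion `𝒱 ⊆ V`
(Constantin–Foias 1988, Ch. 1, (1.3)–(1.5): `V` is the closure of `𝒱` in `H¹`, so `𝒱 ⊆ V`; in
the periodic case Ch. 4, (4.31)/(4.34): `V = {u ∈ H_{1,L} | ū_k = u_{-k}, u₀ = 0, ⟨u_k, k⟩ = 0}`,
`H_{1,L}` being the fields with `∑_k (1 + |k|²) |u_k|² < ∞`). This file **proves** it:
`Torus.smoothSolenoidal_subset_energySpaceV_holds`.

## Proof

Let `v ∈ 𝒱`, i.e. `v =ᵐ f` with `f` smooth, divergence free and mean zero.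

* `v ∈ H`: generators lie in the closure of their span
  (`Torus.smoothSolenoidal_subset_energySpace`, already in the tree).
* `complexify ∘ f ∈ H¹`: a smooth field has finite `H¹` norm — in the tree this is
  `Torus.IsSmooth.memSobolev_one_complexify` (`TorusFourierCalculus`:
  `‖complexify ∘ f‖²_{H¹} = ‖f‖²_{L²} + (4π²)⁻¹ ‖∇f‖²_{L²} < ∞`; Constantin–Foias 1988, (4.31) with
  `α = 1`).
* `MemSobolev` only sees the a.e.-class (`Torus.MemSobolev.ae_eq` below: integrability transfers
  by `MeasureTheory.integrable_congr`, and the Fourier coefficients — hence the spectral norm —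
  agree, `Torus.mFourierCoeff_congr_ae`), and `complexify ∘ v =ᵐ complexify ∘ f`.

No new definitions and no new named facts; net effect: the fact
`Torus.smoothSolenoidal_subset_energySpaceV` is discharged. The proof lives in this sibling file
(rather than in `TorusSobolevSpace` itself) to keep the definitional file's import closure free of
`TorusFourierCalculus` / `TorusVectorParseval`.

## References

* P. Constantin, C. Foias, *Navier–Stokes Equations*, Chicago Lectures in Mathematics, Univ. of
  Chicago Press (1988), Ch. 1, (1.3)–(1.5) (`𝒱`, `H`, `V`); Ch. 4, (4.31), (4.33), (4.34)
  (periodic `H_{α,L}`, `H`, `V`). [ConstantinFoiasNSE1988]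
* R. Temam, *Navier–Stokes Equations and Nonlinear Functional Analysis*, 2nd ed. (1995), Ch. I
  §1.4 (periodic `H`, `V`).
-/

open MeasureTheory Set Filter Topology UnitAddTorus
open scoped ENNReal NNReal

noncomputable section

namespace Literature.Analysis.FunctionSpaces

namespace Torus

variable {d : Type*} [Fintype d]

/-! ## `H^s` membership only sees the a.e.-class -/

section AE

variable {F : Type*} [NormedAddCommGroup F] [NormedSpace ℂ F]

/-- The spectral `H^s` norm only sees the a.e.-class: `f = g` a.e. implies `‖f‖_{H^s} = ‖g‖_{H^s}`,
because a.e.-equal functions have the same Fourier coefficients (`Torus.mFourierCoeff_congr_ae`).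
[folklore] -/
theorem eSobolevNorm_congr_of_ae_eq (s : ℝ) {f g : UnitAddTorus d → F} (h : f =ᵐ[volume] g) :
    eSobolevNorm s f = eSobolevNorm s g := by
  unfold eSobolevNorm
  simp_rw [mFourierCoeff_congr_ae h]

/-- Membership in `H^s(T^d; F)` only sees the a.e.-class: if `f = g` a.e. and `f ∈ H^s` then
`g ∈ H^s` (integrability transfers by `MeasureTheory.integrable_congr`, the spectral norm by
`Torus.eSobolevNorm_congr_of_ae_eq`; cf. Mathlib's `MeasureTheory.MemLp.ae_eq`). [folklore] -/
theorem MemSobolev.ae_eq {s : ℝ} {f g : UnitAddTorus d → F} (h : f =ᵐ[volume] g)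
    (hf : MemSobolev s f) : MemSobolev s g :=
  ⟨(integrable_congr h).1 hf.1, (eSobolevNorm_congr_of_ae_eq s h) ▸ hf.2⟩

/-- `MemSobolev s f ↔ MemSobolev s g` for a.e.-equal `f`, `g`. [folklore] -/
theorem memSobolev_congr_of_ae_eq {s : ℝ} {f g : UnitAddTorus d → F} (h : f =ᵐ[volume] g) :
    MemSobolev s f ↔ MemSobolev s g :=
  ⟨fun hf => hf.ae_eq h, fun hg => hg.ae_eq h.symm⟩

end AE

/-! ## `𝒱 ⊆ V` -/

section Energy

variable [DecidableEq d]

/-- A real vector field a.e. equal to a smooth one has its complexification in `H¹(T^d; ℂ^d)`: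
smooth fields have finite `H¹` norm (`Torus.IsSmooth.memSobolev_one_complexify`;
Constantin–Foias 1988, Ch. 4, (4.31): `‖u‖²_{1,L} = ∑_k (1 + |k|²) |u_k|²`), and `H¹` membership
only sees the a.e.-class (`Torus.MemSobolev.ae_eq`). [folklore] -/
theorem memSobolev_one_complexify_of_ae_eq_isSmooth {v f : UnitAddTorus d → EuclideanSpace ℝ d}
    (hf : IsSmooth f) (hvf : v =ᵐ[volume] f) :
    MemSobolev 1 (EuclideanSpace.complexify ∘ v) :=
  (hf.memSobolev_one_complexify).ae_eq (hvf.symm.fun_comp EuclideanSpace.complexify)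

/-- Discharge of the named fact `Torus.smoothSolenoidal_subset_energySpaceV`: **`𝒱 ⊆ V`** — every
`L²` class of a smooth divergence-free mean-zero vector field on `T^d` lies in the energy space
`V = H ∩ H¹` (Constantin–Foias 1988, Ch. 1, (1.5): `V` is the `H¹`-closure of `𝒱`; periodic case
Ch. 4, (4.34): `V = {u ∈ H_{1,L} | ū_k = u_{-k}, u₀ = 0, ⟨u_k, k⟩ = 0}`). Proof: `𝒱 ⊆ H` by
construction of `H` as the closure of `span 𝒱` (`Torus.smoothSolenoidal_subset_energySpace`), and
the `H¹` condition holds for the smooth representative and transfers along the a.e. equality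
(`Torus.memSobolev_one_complexify_of_ae_eq_isSmooth`).
[cite: ConstantinFoiasNSE1988, Ch. 4 (4.34); Ch. 1 (1.5)] -/
theorem smoothSolenoidal_subset_energySpaceV_holds :
    smoothSolenoidal_subset_energySpaceV (d := d) := by
  intro v hv
  refine ⟨smoothSolenoidal_subset_energySpace hv, ?_⟩
  obtain ⟨f, hf, -, -, hvf⟩ := hv
  exact memSobolev_one_complexify_of_ae_eq_isSmooth hf hvf

end Energy

end Torus

end Literature.Analysis.FunctionSpaces
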